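import Summits.BirchSwinnertonDyer.BirchSwinnertonDyer.Theorems.SylvesterTwoHeegnerIndexThmCCubicTwistDescentHSY
import Summits.BirchSwinnertonDyer.BirchSwinnertonDyer.Theorems.SylvesterTwoHeegnerIndexThmCOfTwoIntegral
import HarnessLib

/-!
# Route `SylvesterTwoHeegnerIndex` (rung K7t): THEOREM C (item 19802) FROM Hu–Shu–Yin's CM-POINT LAWS
# at the `E₁(L_{(p)})` level — the (C-d) assembly in the kernel

HONEST FRAMING (cell b2b-bsdres, seat x1b GEN 51 = O12 class lead; file `--supports
stmt-BirchSwinnertonDyer-19802 --as helper`). THEOREM C (`HSYPointTwoDivisibleSevenModNine`, crux r201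
of K7t) is NOT proved here and stays OPEN: this file ASSEMBLES the kernel pieces of MEMO-bsd-cm-two v2.8
§15.5 (C-d) (x1b [153–155], two's `2`-integrality engine `…ThmCOfTwoIntegral` / `…TwoAdicPairModelNonneg`)
into ONE implication whose hypothesis is exactly what Hu–Shu–Yin's printed CM theory + the cell's step
(C-b)/(C-c) deliver at the level of the curve `E₁ : y² = x³ − 432` over `L = L_{(p)} = K(∛p)`:

  (LAWS_p)  for the prime `p ≡ 7 (9)` and the models `B ≅ E_p`, `A ≅ E_{3p²}` with `#Ш_an = qB, qA`:
  a quadratic field `K ∋ ω`, a rational generator `P₀` (in `ι`-form), a Galois extension `L/K` with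
  `Gal(L/K) = {1, σ, σ²}`, `c ∈ L`, `c³ = p`, `σ c = ωc` (`L = K(∛p)`, `σ = σ_{ω₃}`), maps `[ω]` on
  `E₁(L)` and `φ′ : E₁(L) → E_p(L)` acting by `(x,y) ↦ (ωx, y)`, `(x,y) ↦ (c²x, c³y)`, points
  `R′, t′, T ∈ E₁(L)` with **`σR′ = [ω]R′ + t′`, `t′ ∈ E₁[√−3]`** ([HuShuYin2019] Cor 2.5, where
  `R = 2R′` is the cell's (C-b)+(C-c)+(C-d)₁: `σ_{−1}` fixes `P₀` so the trace doubles), `T ∈ E₁[3]`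
  (HSY's `T`), and a point `Y ∈ B(K)` which over `L` IS `φ′(2R′ − T)` (HSY's `Y = φ′(R − T)`, p. 8) and
  satisfies the display `(qB·qA)·ĥ_K(ι P₀) = 2⁻²·ĥ_K(Y)` ([HuShuYin2019] (bsd) p. 12 for THIS `Y` —
  the tree's fact p443765 asserts it for SOME `Y` only);

and whose conclusion is THEOREM C. Theorems:

* `exists_eq_two_smul_add_torsion_of_cmPointLaws` (§1, one `p`, model level): under (LAWS_p) minus the
  display, **`Y = 2•Y′ + T″` in `B(K)` with `T″` torsion** — by x1b [154] `exists_threeTorsion_map_sub_eq_omegaRot_sub`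
  + [155] `exists_point_eq_twistMap_of_generator` (Galois descent of `Y′ = φ′(R′ − T′)`) + [154]
  `three_nsmul_twistMap_sub_two_nsmul`, transported to the model `B` (tree `pointEquivBaseChange`);
* `pairProductTwoIntegralSevenModNine_of_cmPointLaws` (§2): (LAWS_p) for every `p ≡ 7 (9)` ⟹
  `SylvesterTwoNonneg.PairProductTwoIntegralSevenModNine` (two's `add_two_le_padicValRat_two_of_model_of_twoDivisible`);
* `hsyPointTwoDivisibleSevenModNine_of_cmPointLaws` (§2): + the printed display fact ⟹ the ROUTE DECL
  `Theses.SylvesterTwoHeegnerIndex.HSYPointTwoDivisibleSevenModNine` (two's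
  `hsyPointTwoDivisibleSevenModNine_of_heightDisplay_of_twoIntegral`).

So the NON-KERNEL residue of item 19802 is now displayed as ONE hypothesis: (LAWS_p) for all `p ≡ 7 (9)` —
i.e. HSY Thm 2.3 (1) / Cor 2.5 / (bsd) for the explicit `Y` (PRINT) and «`σ_{−1}P₀ = P₀`» (memo (C-b)+(C-c):
Shimura reciprocity, no tree carrier — x1b's (α) scoping note, evidence #4 on 19802). NO definition, NO
named fact, NO sorry; axioms standard; nothing about `Ш` is claimed; closes no item; nothing booked.
References: MEMO-bsd-cm-two v2.8 §15.5, §40.1; [HuShuYin2019] pp. 7–8, 12.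
-/

set_option autoImplicit false
-- the Summit-side namespace `Summit.BirchSwinnertonDyer.BirchSwinnertonDyer.…` (summit = problem) is mandated by D-0017
set_option linter.dupNamespace false

noncomputable section

open scoped Classical

open WeierstrassCurve WeierstrassCurve.Affine WeierstrassCurve.Affine.Point

namespace Summit.BirchSwinnertonDyer.BirchSwinnertonDyer.Theorems.SylvesterTwoThmCTwist

open SylvesterTwoCMNormForm SylvesterTwoThmCTorsion
open Literature.NumberTheory.EllipticCurves Literature.NumberTheory.EllipticCurves.HuShuYin2019

/-! ## §1 One prime, model level: `Y = 2•Y′ + T″` in `B(K)` from the CM-point laws on `E₁(L)` -/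

section Model

variable {K : Type} [Field K] [NumberField K] {ω : K} (hω : ω ^ 2 + ω + 1 = 0)
  {L : Type} [Field L] [CharZero L] [Algebra K L]
  {p : ℕ} {c : L} (hc : c ^ 3 = ((p : ℚ) : L)) (hp0 : (p : ℚ) ≠ 0)

include hω hc hp0 in
/-- **THE (C-d) ASSEMBLY FOR ONE PRIME, MODEL LEVEL.** `K ∋ ω` a number field, `B/ℚ` with
`(C • B)_K = (E_p)_K`, `E_p = cubeSumCurve p`, `L/K` Galois with `Gal(L/K) = {1, σ, σ²}`, `c ∈ L`, `c³ = p`, `σ c = ωc`;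
`θ = [ω]` on `E₁(L)` and `φ : E₁(L) → E_p(L)` the cubic-twist scaling (ANY additive maps acting by the
printed formulae); `R′, t′, T ∈ E₁(L)` with `σR′ = [ω]R′ + t′`, `t′ ∈ E₁[√−3]`, `3•T = 0`; `Y ∈ B(K)` whose
image in `E_p(L)` (along `B_K ≅ (E_p)_K ⊂ (E_p)_L`) is `φ(2•R′ − T)`. THEN `Y = 2•Y′ + T″` with `T″` of
finite order — memo §15.5 (C-d) «`Y ≡ 2Y′` in `E_p(K)/tors`», kernel. [cite: HuShuYin2019, p. 8] -/
theorem exists_eq_two_smul_add_torsion_of_cmPointLaws [IsGalois K L]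
    (B : WeierstrassCurve ℚ) [B.IsElliptic] (C : VariableChange ℚ)
    (hCK : (C • B).baseChange K = (cubeSumCurve (p : ℚ)).baseChange K)
    (σ : L ≃ₐ[K] L) (hgen : ∀ τ : L ≃ₐ[K] L, τ = 1 ∨ τ = σ ∨ τ = σ * σ)
    (hσc : σ c = algebraMap K L ω * c)
    {θ : ((cubeSumCurve 1).baseChange L).toAffine.Point → ((cubeSumCurve 1).baseChange L).toAffine.Point}
    (hθ0 : θ 0 = 0)
    (hθ : ∀ (x y : L) (h : ((cubeSumCurve 1).baseChange L).toAffine.Nonsingular x y),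
      θ (.some x y h) = .some (algebraMap K L ω * x) y
        (nonsingular_rootMul (cubeSumCurve_baseChange_a₁ 1) (cubeSumCurve_baseChange_a₂ 1)
          (cubeSumCurve_baseChange_a₃ 1) (cubeSumCurve_baseChange_a₄ 1)
          (omega_pow_three (omega_algebraMap (L := L) hω)) h))
    (hθadd : ∀ P Q, θ (P + Q) = θ P + θ Q)
    {φ : ((cubeSumCurve 1).baseChange L).toAffine.Point → ((cubeSumCurve (p : ℚ)).baseChange L).toAffine.Point}
    (hφ0 : φ 0 = 0)
    (hφ : ∀ (x y : L) (h : ((cubeSumCurve 1).baseChange L).toAffine.Nonsingular x y),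
      φ (.some x y h) = .some (c ^ 2 * x) (c ^ 3 * y)
        (nonsingular_twist (cbrt_ne_zero hc hp0) (cubeSumCurve_baseChange_a₁ 1)
          (cubeSumCurve_baseChange_a₂ 1) (cubeSumCurve_baseChange_a₃ 1) (cubeSumCurve_baseChange_a₄ 1)
          (cubeSumCurve_baseChange_a₁ p) (cubeSumCurve_baseChange_a₂ p) (cubeSumCurve_baseChange_a₃ p)
          (cubeSumCurve_baseChange_a₄ p) (cubeSumCurve_baseChange_a₆_twist hc) h))
    (hφadd : ∀ P Q, φ (P + Q) = φ P + φ Q)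
    {R' t' T : ((cubeSumCurve 1).baseChange L).toAffine.Point}
    (hR' : Affine.Point.map (σ : L →ₐ[K] L) R' = θ R' + t')
    (ht' : t' = 0 ∨
      (∃ h, t' = .some 0 (12 * (2 * algebraMap K L ω + 1)) h) ∨
      (∃ h, t' = .some 0 (-(12 * (2 * algebraMap K L ω + 1))) h))
    (hT : (3 : ℕ) • T = 0)
    (Y : (B.baseChange K).toAffine.Point)
    (hY : Affine.Point.map (algebraMap K L).toRatAlgHom
        (Affine.Point.congrEquiv hCK (VariableChange.pointEquivBaseChange B C K Y)) =
      φ ((2 : ℕ) • R' - T)) :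
    ∃ Y' T'' : (B.baseChange K).toAffine.Point, IsOfFinAddOrder T'' ∧ Y = (2 : ℤ) • Y' + T'' := by
  -- abbreviations and standing facts
  have hωL := omega_algebraMap (L := L) hω
  have h2L : (2 : L) ≠ 0 := by norm_num
  have h3L : (3 : L) ≠ 0 := by norm_num
  have hc0 := cbrt_ne_zero hc hp0
  have hσω : (σ : L →+* L) (algebraMap K L ω) = algebraMap K L ω := σ.commutes ω
  have ha1 := cubeSumCurve_baseChange_a₁ (L := L) 1
  have ha2 := cubeSumCurve_baseChange_a₂ (L := L) 1
  have ha3 := cubeSumCurve_baseChange_a₃ (L := L) 1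
  have ha4 := cubeSumCurve_baseChange_a₄ (L := L) 1
  have ha6 := cubeSumCurve_one_baseChange_a₆ (L := L)
  -- the Galois action on `E₁(L)` (Mathlib's `Point.map`) has the abstract shape of [153–155]
  set s : ((cubeSumCurve 1).baseChange L).toAffine.Point → ((cubeSumCurve 1).baseChange L).toAffine.Point :=
    fun P => Affine.Point.map (σ : L →ₐ[K] L) P with hs_def
  have hs0 : s 0 = 0 := Affine.Point.map_zero _
  have hs : ∀ (x y : L) (h : ((cubeSumCurve 1).baseChange L).toAffine.Nonsingular x y),
      s (.some x y h) = .some ((σ : L →+* L) x) ((σ : L →+* L) y)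
        (nonsingular_map ha1 ha2 ha3 ha4 (map_a₆_EOne ha6) h) :=
    fun x y h => Affine.Point.map_some _ h
  have hsadd : ∀ P Q, s (P + Q) = s P + s Q := fun P Q => map_add _ P Q
  -- `t′ ∈ E₁[√−3]` in the currency of [154]
  have ht'' : t' = 0 ∨
      t' = .some 0 (12 * (2 * algebraMap K L ω + 1)) (nonsingular_zero_twelveSqrt h2L ha1 ha2 ha3 ha4 ha6 hωL h3L) ∨
      t' = .some 0 (-(12 * (2 * algebraMap K L ω + 1)))
        (nonsingular_zero_neg_twelveSqrt h2L ha1 ha2 ha3 ha4 ha6 hωL h3L) := by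
    rcases ht' with h | ⟨_, h⟩ | ⟨_, h⟩
    · exact Or.inl h
    · exact Or.inr (Or.inl h)
    · exact Or.inr (Or.inr h)
  -- (C-d)₂ + (C-d)₃: a σ-fixed `T′ ∈ E₁[3]` with `σ(R′ − T′) = [ω](R′ − T′)`
  obtain ⟨T', hT'3, -, hrel⟩ := exists_threeTorsion_map_sub_eq_omegaRot_sub hωL h2L h3L ha1 ha2 ha3 ha4 ha6
    hσω hs0 hs hθ0 hθ hsadd hθadd hR' ht''
  -- Galois descent: `φ(R′ − T′)` comes from `E_p(K)`
  obtain ⟨Y₀, hY₀⟩ := exists_point_eq_twistMap_of_generator hω hc hp0 hθ0 hθ hφ0 hφ σ hσc hgen (R' - T') hrel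
  -- the endgame: `3•(φ(2R′ − T) − 2•φ(R′ − T′)) = 0`
  have h3 : (3 : ℕ) • (φ ((2 : ℕ) • R' - T) - (2 : ℕ) • φ (R' - T')) = 0 := by
    have e := three_nsmul_twistMap_sub_two_nsmul (AddMonoidHom.mk' φ hφadd) (R := (2 : ℕ) • R') rfl hT hT'3
    simpa only [AddMonoidHom.mk'_apply] using e
  -- transport to the model `B`: `ψ : B(K) ≃+ (E_p)_K(K)`, `j : (E_p)(K) →+ (E_p)(L)` injective
  set ψ : (B.baseChange K).toAffine.Point ≃+ ((cubeSumCurve (p : ℚ)).baseChange K).toAffine.Point :=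
    (VariableChange.pointEquivBaseChange B C K).trans (Affine.Point.congrEquiv hCK) with hψ_def
  set j : ((cubeSumCurve (p : ℚ)).baseChange K).toAffine.Point →+
      ((cubeSumCurve (p : ℚ)).baseChange L).toAffine.Point :=
    Affine.Point.map (algebraMap K L).toRatAlgHom with hj_def
  have hjψY : j (ψ Y) = φ ((2 : ℕ) • R' - T) := hY
  refine ⟨ψ.symm Y₀, Y - (2 : ℤ) • ψ.symm Y₀, ?_, by abel⟩
  -- `3 • (Y − 2•Y′) = 0` because `j ∘ ψ` is an injective homomorphism
  have hinj : Function.Injective (fun P => j (ψ P)) :=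
    (Affine.Point.map_injective (W' := cubeSumCurve (p : ℚ)) _).comp ψ.injective
  have hzero : (3 : ℕ) • (Y - (2 : ℤ) • ψ.symm Y₀) = 0 := by
    apply hinj
    show j (ψ ((3 : ℕ) • (Y - (2 : ℤ) • ψ.symm Y₀))) = j (ψ 0)
    rw [_root_.map_zero, _root_.map_zero, map_nsmul, map_nsmul, map_sub, map_sub, map_zsmul, map_zsmul,
      ψ.apply_symm_apply, hjψY, hY₀, ← natCast_zsmul, Nat.cast_ofNat]
    · have e : (2 : ℤ) • φ (R' - T') = (2 : ℕ) • φ (R' - T') := by norm_cast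
      rw [e]; exact h3
  exact isOfFinAddOrder_iff_nsmul_eq_zero.mpr ⟨3, by norm_num, hzero⟩

end Model

/-! ## §2 THEOREM C from the CM-point laws at every `p ≡ 7 (mod 9)` -/

/-- **`2`-INTEGRALITY OF `#Ш_an(E_p)·#Ш_an(E_{3p²})` FROM THE CM-POINT LAWS.** If for every prime
`p ≡ 7 (9)` with `3 ∉ 𝔽_p^{×3}`, every pair of minimal models `B ≅ E_p`, `A ≅ E_{3p²}` and their analytic
orders `qB, qA`, the data (LAWS_p) of the module docstring exist — a quadratic `K ∋ ω` with
`rank_ℤ B(K) = 2`, a rational generator `P₀`, `L/K` Galois cyclic cubic with `c³ = p`, `σc = ωc`, additive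
`[ω]` and `φ′`, points `R′, t′, T` with Hu–Shu–Yin's laws, and `Y ∈ B(K)` equal to `φ′(2R′ − T)` over `L`
with the display `(qB·qA)·ĥ_K(ι P₀) = 2⁻²·ĥ_K(Y)` — then `0 ≤ ord₂(qB·qA)`
(`SylvesterTwoNonneg.PairProductTwoIntegralSevenModNine`). [cite: HuShuYin2019, pp. 8, 12] -/
theorem pairProductTwoIntegralSevenModNine_of_cmPointLaws
    (hLaws : ∀ (p : ℕ), p.Prime → p % 9 = 7 → (¬ ∃ x : ZMod p, x ^ 3 = 3) →
      ∀ (A B : WeierstrassCurve ℚ) [A.IsElliptic] [A.IsGloballyMinimal] [B.IsElliptic] [B.IsGloballyMinimal],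
      (∃ C : VariableChange ℚ, C • B = cubeSumCurve (p : ℚ)) →
      (∃ C : VariableChange ℚ, C • A = cubeSumCurve (3 * (p : ℚ) ^ 2)) →
      ∀ (qB qA : ℚ), shaAn B = (qB : ℂ) → shaAn A = (qA : ℂ) →
      ∃ (K : Type) (_ : Field K) (_ : NumberField K) (ω : K) (_ : ω ^ 2 + ω + 1 = 0)
        (_ : Module.finrank ℚ K = 2) (_ : (B.baseChange K).mordellWeilRank = 2)
        (P₀ : B.toAffine.Point) (_ : ¬ IsOfFinAddOrder (QuadraticDescent.incl K B P₀))
        (_ : ∀ Q : B.toAffine.Point, ∃ m : ℤ,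
          IsOfFinAddOrder (QuadraticDescent.incl K B Q - m • QuadraticDescent.incl K B P₀))
        (C : VariableChange ℚ) (_ : C • B = cubeSumCurve (p : ℚ))
        (hCK : (C • B).baseChange K = (cubeSumCurve (p : ℚ)).baseChange K)
        (L : Type) (_ : Field L) (_ : CharZero L) (_ : Algebra K L) (_ : IsGalois K L)
        (σ : L ≃ₐ[K] L) (_ : ∀ τ : L ≃ₐ[K] L, τ = 1 ∨ τ = σ ∨ τ = σ * σ)
        (c : L) (_ : c ^ 3 = ((p : ℚ) : L)) (_ : σ c = algebraMap K L ω * c)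
        (θ : ((cubeSumCurve 1).baseChange L).toAffine.Point → ((cubeSumCurve 1).baseChange L).toAffine.Point)
        (_ : θ 0 = 0)
        (_ : ∀ (x y : L) (h : ((cubeSumCurve 1).baseChange L).toAffine.Nonsingular x y),
          ∃ h', θ (.some x y h) = .some (algebraMap K L ω * x) y h')
        (_ : ∀ P Q, θ (P + Q) = θ P + θ Q)
        (φ : ((cubeSumCurve 1).baseChange L).toAffine.Point →
          ((cubeSumCurve (p : ℚ)).baseChange L).toAffine.Point)
        (_ : φ 0 = 0)
        (_ : ∀ (x y : L) (h : ((cubeSumCurve 1).baseChange L).toAffine.Nonsingular x y),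
          ∃ h', φ (.some x y h) = .some (c ^ 2 * x) (c ^ 3 * y) h')
        (_ : ∀ P Q, φ (P + Q) = φ P + φ Q)
        (R' t' T : ((cubeSumCurve 1).baseChange L).toAffine.Point)
        (_ : Affine.Point.map (σ : L →ₐ[K] L) R' = θ R' + t')
        (_ : t' = 0 ∨ (∃ h, t' = .some 0 (12 * (2 * algebraMap K L ω + 1)) h) ∨
          (∃ h, t' = .some 0 (-(12 * (2 * algebraMap K L ω + 1))) h))
        (_ : (3 : ℕ) • T = 0)
        (Y : (B.baseChange K).toAffine.Point)
        (_ : Affine.Point.map (algebraMap K L).toRatAlgHom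
            (Affine.Point.congrEquiv hCK (VariableChange.pointEquivBaseChange B C K Y)) =
          φ ((2 : ℕ) • R' - T)),
        ((qB * qA : ℚ) : ℝ) * canonicalHeight (QuadraticDescent.incl K B P₀) =
          (2 : ℝ) ^ (-2 : ℤ) * canonicalHeight Y ∧ qB * qA ≠ 0) :
    SylvesterTwoNonneg.PairProductTwoIntegralSevenModNine := by
  intro p hp h7 h3 A B _ _ _ _ hB hA qB qA hqB hqA
  obtain ⟨K, _, _, ω, hω, h2K, hrank, P₀, hP, hgen, C, hC, hCK, L, _, _, _, _, σ, hg, c, hc, hσc, θ, hθ0,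
    hθ', hθadd, φ, hφ0, hφ', hφadd, R', t', T, hR', ht', hT, Y, hY, hid, hq⟩ :=
    hLaws p hp h7 h3 A B hB hA qB qA hqB hqA
  have hp2 : p ≠ 2 := by rintro rfl; norm_num at h7
  have hp0 : (p : ℚ) ≠ 0 := by exact_mod_cast hp.ne_zero
  -- the `∃ h'` shapes of `θ`, `φ` give the pinned shapes of §1 (proof irrelevance)
  have hθ : ∀ (x y : L) (h : ((cubeSumCurve 1).baseChange L).toAffine.Nonsingular x y),
      θ (.some x y h) = .some (algebraMap K L ω * x) y
        (nonsingular_rootMul (cubeSumCurve_baseChange_a₁ 1) (cubeSumCurve_baseChange_a₂ 1)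
          (cubeSumCurve_baseChange_a₃ 1) (cubeSumCurve_baseChange_a₄ 1)
          (omega_pow_three (omega_algebraMap (L := L) hω)) h) := by
    intro x y h; obtain ⟨_, e⟩ := hθ' x y h; exact e
  have hφ : ∀ (x y : L) (h : ((cubeSumCurve 1).baseChange L).toAffine.Nonsingular x y),
      φ (.some x y h) = .some (c ^ 2 * x) (c ^ 3 * y)
        (nonsingular_twist (cbrt_ne_zero hc hp0) (cubeSumCurve_baseChange_a₁ 1)
          (cubeSumCurve_baseChange_a₂ 1) (cubeSumCurve_baseChange_a₃ 1) (cubeSumCurve_baseChange_a₄ 1)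
          (cubeSumCurve_baseChange_a₁ p) (cubeSumCurve_baseChange_a₂ p) (cubeSumCurve_baseChange_a₃ p)
          (cubeSumCurve_baseChange_a₄ p) (cubeSumCurve_baseChange_a₆_twist hc) h) := by
    intro x y h; obtain ⟨_, e⟩ := hφ' x y h; exact e
  have h2div := exists_eq_two_smul_add_torsion_of_cmPointLaws hω hc hp0 B C hCK σ hg hσc hθ0 hθ
    hθadd hφ0 hφ hφadd hR' ht' hT Y hY
  have hle := SylvesterTwoNonneg.add_two_le_padicValRat_two_of_model_of_twoDivisible hω h2K hp hp2 B C hC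
    hrank P₀ hP hgen Y hq hid h2div
  linarith

/-- **THEOREM C FROM THE CM-POINT LAWS** (route decl): Hu–Shu–Yin's printed display (tree fact
`shaAnPair_mul_height_eq_two_zpow_mul_height`) + (LAWS_p) for every `p ≡ 7 (9)` ⟹
`HSYPointTwoDivisibleSevenModNine` — two's `hsyPointTwoDivisibleSevenModNine_of_heightDisplay_of_twoIntegral`
after §2's integrality. The item stays OPEN: (LAWS_p) contains «`σ_{−1}` fixes `P₀`» (memo (C-b)+(C-c),
Shimura reciprocity — no tree carrier) and HSY Thm 2.3 (1) / Cor 2.5 / (bsd) for the explicit `Y`.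
[cite: HuShuYin2019, pp. 8, 12] -/
theorem hsyPointTwoDivisibleSevenModNine_of_cmPointLaws
    (hH : shaAnPair_mul_height_eq_two_zpow_mul_height)
    (hLaws : ∀ (p : ℕ), p.Prime → p % 9 = 7 → (¬ ∃ x : ZMod p, x ^ 3 = 3) →
      ∀ (A B : WeierstrassCurve ℚ) [A.IsElliptic] [A.IsGloballyMinimal] [B.IsElliptic] [B.IsGloballyMinimal],
      (∃ C : VariableChange ℚ, C • B = cubeSumCurve (p : ℚ)) →
      (∃ C : VariableChange ℚ, C • A = cubeSumCurve (3 * (p : ℚ) ^ 2)) →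
      ∀ (qB qA : ℚ), shaAn B = (qB : ℂ) → shaAn A = (qA : ℂ) →
      ∃ (K : Type) (_ : Field K) (_ : NumberField K) (ω : K) (_ : ω ^ 2 + ω + 1 = 0)
        (_ : Module.finrank ℚ K = 2) (_ : (B.baseChange K).mordellWeilRank = 2)
        (P₀ : B.toAffine.Point) (_ : ¬ IsOfFinAddOrder (QuadraticDescent.incl K B P₀))
        (_ : ∀ Q : B.toAffine.Point, ∃ m : ℤ,
          IsOfFinAddOrder (QuadraticDescent.incl K B Q - m • QuadraticDescent.incl K B P₀))
        (C : VariableChange ℚ) (_ : C • B = cubeSumCurve (p : ℚ))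
        (hCK : (C • B).baseChange K = (cubeSumCurve (p : ℚ)).baseChange K)
        (L : Type) (_ : Field L) (_ : CharZero L) (_ : Algebra K L) (_ : IsGalois K L)
        (σ : L ≃ₐ[K] L) (_ : ∀ τ : L ≃ₐ[K] L, τ = 1 ∨ τ = σ ∨ τ = σ * σ)
        (c : L) (_ : c ^ 3 = ((p : ℚ) : L)) (_ : σ c = algebraMap K L ω * c)
        (θ : ((cubeSumCurve 1).baseChange L).toAffine.Point → ((cubeSumCurve 1).baseChange L).toAffine.Point)
        (_ : θ 0 = 0)
        (_ : ∀ (x y : L) (h : ((cubeSumCurve 1).baseChange L).toAffine.Nonsingular x y),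
          ∃ h', θ (.some x y h) = .some (algebraMap K L ω * x) y h')
        (_ : ∀ P Q, θ (P + Q) = θ P + θ Q)
        (φ : ((cubeSumCurve 1).baseChange L).toAffine.Point →
          ((cubeSumCurve (p : ℚ)).baseChange L).toAffine.Point)
        (_ : φ 0 = 0)
        (_ : ∀ (x y : L) (h : ((cubeSumCurve 1).baseChange L).toAffine.Nonsingular x y),
          ∃ h', φ (.some x y h) = .some (c ^ 2 * x) (c ^ 3 * y) h')
        (_ : ∀ P Q, φ (P + Q) = φ P + φ Q)
        (R' t' T : ((cubeSumCurve 1).baseChange L).toAffine.Point)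
        (_ : Affine.Point.map (σ : L →ₐ[K] L) R' = θ R' + t')
        (_ : t' = 0 ∨ (∃ h, t' = .some 0 (12 * (2 * algebraMap K L ω + 1)) h) ∨
          (∃ h, t' = .some 0 (-(12 * (2 * algebraMap K L ω + 1))) h))
        (_ : (3 : ℕ) • T = 0)
        (Y : (B.baseChange K).toAffine.Point)
        (_ : Affine.Point.map (algebraMap K L).toRatAlgHom
            (Affine.Point.congrEquiv hCK (VariableChange.pointEquivBaseChange B C K Y)) =
          φ ((2 : ℕ) • R' - T)),
        ((qB * qA : ℚ) : ℝ) * canonicalHeight (QuadraticDescent.incl K B P₀) =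
          (2 : ℝ) ^ (-2 : ℤ) * canonicalHeight Y ∧ qB * qA ≠ 0) :
    Summit.BirchSwinnertonDyer.BirchSwinnertonDyer.Theses.SylvesterTwoHeegnerIndex.HSYPointTwoDivisibleSevenModNine :=
  SylvesterTwoNonneg.hsyPointTwoDivisibleSevenModNine_of_heightDisplay_of_twoIntegral hH
    (pairProductTwoIntegralSevenModNine_of_cmPointLaws hLaws)

end Summit.BirchSwinnertonDyer.BirchSwinnertonDyer.Theorems.SylvesterTwoThmCTwist

end
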